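import Summits.MatrixMultiplication.OmegaCensus.STPPVosperSlackTwoSoundAT
import Summits.MatrixMultiplication.OmegaCensus.STPPVosperSlackTwoLawABQ

/-!
# ω-census (abelian STPP census): the slack-2 partition law for leaves with several other blocks — REDUCTION of case A and the A/B′ law (kernel tool)

HONEST FRAMING (pub-omega census; verbatim): lottery ticket; floor = certified bounds/negative ranges.
Census STRUCTURE (seat pub-omega-stpp-1 gen 33, 2026-08-28), family (b2).  The general-`N` analogues of stpp-1 g32's `caseADeadQ'_false_of_isAP`
(`STPPVosperSlackTwoSoundAReduce.lean`) and of stpp-2 g27's `slack_two_caseC_of_rowsQ` (`STPPVosperSlackTwoLawABQ.lean`) for the table-form checker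
`caseADeadT` in the pinned-interval gauge (`STPPVosperSlackTwoCheckersT.lean`, soundness `caseADeadT_false_of_normal_form`):

* `DU_eq_image_affine` : under a common dilation `u` and per-block translations whose difference between the two roles is a constant `δ`, a union of
  difference sets `⋃_{k∈I}(F_k − E_k)` is mapped by `y ↦ u·y + δ`;
* `caseADeadT_false_of_isAP` : in case (A) of `slack_two_shapes` at block `i` (`Aᵢ` and `Y°` progressions of the same difference `d ≠ 0`, `a + L ≤ p`),
  for ANY base point `β₀`, the checker returns `false` on the increasing value list of `d⁻¹·(Bᵢ − β₀)`, given dead tables — by the normalisation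
  `x ↦ d⁻¹x` (`isSTPP_dilate`), block-`i` translation `Aᵢ ↦ [0, a)`, global `B`-offset `β₀ ↦ 0`, global `C`-offset `Y° ↦ [a − 1, a − 1 + L)`
  (`IsSTPP.translate_shiftBC`); no re-indexing of the blocks is needed;
* `slack_two_caseC_of_rowsT` : for an STPP family with `N ≥ 2` non-empty blocks at slack 2 (`z + b + vol + a + L = p`, `a, b, z, L ≥ 2`), rows
  `dihedralSmaller p Q ∨ caseADeadT … Q tbl` over the free shapes (case A: `Q ↔ Bᵢ`, table `tblA` dead for the sizes `szsA` of the other blocks;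
  case B′: the role-swapped family `(B, A, C)`, `Q ↔ Aᵢ`, sizes `szsB` with `a_k, b_k` exchanged) leave only case (C): `#SY = a + L`, `#T = b + z`,
  `W ⊔ SY ⊔ T = ℤ/p` (dihedral WLOG by `exists_dihedralSmaller_false`, `IsAP.neg_diff`).
UNCONDITIONAL; no `decide`.  Nothing here is progress on `ω`.

References: H. Cohn, R. Kleinberg, B. Szegedy, C. Umans, FOCS 2005 (arXiv:math/0511460), Def. 5.1; A. G. Vosper, J. London Math. Soc. 31 (1956).
-/

open Finset
open scoped Pointwise

namespace Summit.MatrixMultiplication.OmegaCensus.CubeNB.S2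

open Literature.Computability.AlgebraicComplexity
open Literature.Combinatorics.Additive
open Summit.MatrixMultiplication.OmegaCensus.STPPKneser
open Summit.MatrixMultiplication.OmegaCensus.CubeNB.Bits

variable {p : ℕ} [hp : Fact p.Prime]

/-! ## §1 Unions of difference sets under an affine normalisation -/

/-- **`⋃_{k∈I}(F_k − E_k)` under `x ↦ u·x + (per-block shift)`.**  If `E′_k = u·E_k + e_E(k)` and `F′_k = u·F_k + e_F(k)` with `e_F(k) − e_E(k) = δ` for
all `k`, then `DU E′ F′ I = (DU E F I).image (y ↦ u·y + δ)`. [cite: CohnKleinbergSzegedyUmans2005, Def. 5.1] -/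
theorem DU_eq_image_affine {N : ℕ} {E F E' F' : Fin N → Finset (ZMod p)} (u δ : ZMod p) (eE eF : Fin N → ZMod p)
    (hδ : ∀ k, eF k - eE k = δ)
    (hE : ∀ k x, x ∈ E' k ↔ ∃ v ∈ E k, u * v + eE k = x) (hF : ∀ k x, x ∈ F' k ↔ ∃ v ∈ F k, u * v + eF k = x) (I : Finset (Fin N)) :
    DU E' F' I = (DU E F I).image fun y => u * y + δ := by
  ext x
  simp only [DU, mem_biUnion, mem_D, mem_image]
  constructor
  · rintro ⟨k, hk, e', he', f', hf', rfl⟩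
    obtain ⟨e, he, rfl⟩ := (hE k e').1 he'
    obtain ⟨f, hf, rfl⟩ := (hF k f').1 hf'
    refine ⟨f - e, ⟨k, hk, e, he, f, hf, rfl⟩, ?_⟩
    rw [← hδ k]; ring
  · rintro ⟨y, ⟨k, hk, e, he, f, hf, rfl⟩, rfl⟩
    refine ⟨k, hk, u * e + eE k, (hE k _).2 ⟨e, he, rfl⟩, u * f + eF k, (hF k _).2 ⟨f, hf, rfl⟩, ?_⟩
    rw [← hδ k]; ring

/-! ## §2 Reduction of case A to normal form -/

/-- **SOUNDNESS of the table-form case-A checker (case (A) of `slack_two_shapes`, any number of blocks).**  If block `i` of an STPP family of `ℤ/p`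
with `N ≥ 2` non-empty blocks has `Aᵢ` and `Y° = ⋃_{k≠i}(C_k − B_k)` progressions of the same non-zero difference `d` (`a + L ≤ p`), the other blocks
`ks` have sizes `szs`, and every entry of `tbl` is `CoverDead p N i szs`, then for ANY base point `β₀` (in the law: an element of `Bᵢ`, so that `0` is in the list)
the checker `caseADeadT` returns `false` on the increasing value list of `d⁻¹·(Bᵢ − β₀)`. [cite: CohnKleinbergSzegedyUmans2005, Def. 5.1] [cite: Vosper1956, main theorem; Nathanson1996, Thm 2.7] -/
theorem caseADeadT_false_of_isAP {N : ℕ} {A B C : Fin N → Finset (ZMod p)} (hS : IsSTPP A B C)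
    (hA : ∀ k, (A k).Nonempty) (hB : ∀ k, (B k).Nonempty) (hC : ∀ k, (C k).Nonempty) (i : Fin N)
    (hI : ((univ : Finset (Fin N)).erase i).Nonempty) {a c L z : ℕ} (ha : #(A i) = a) (hc : #(C i) = c)
    (hz : ∑ k ∈ univ.erase i, #(A k) * #(C k) = z) (hL : ∑ k ∈ univ.erase i, #(B k) * #(C k) = L) (hap : a + L ≤ p)
    {d : ZMod p} (hd : d ≠ 0) (hAP : IsAP (A i) d) (hYAP : IsAP (DU B C (univ.erase i)) d) (β₀ : ZMod p)
    (ks : List (Fin N)) (hks : ks.Nodup) (hksi : ∀ k, k ∈ ks ↔ k ≠ i) {szs : List (ℕ × ℕ × ℕ)}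
    (hszs : ks.map (fun k => (#(A k), #(B k), #(C k))) = szs)
    {tbl : List (List ℕ × List ℕ)} (hdead : ∀ e ∈ tbl, CoverDead p N i szs e.1 e.2) :
    caseADeadT p a c L z (((B i).image fun x => (d⁻¹ * (x - β₀)).val).sort (· ≤ ·)) tbl = false := by
  set u : ZMod p := d⁻¹ with hu
  have hu0 : u ≠ 0 := inv_ne_zero hd
  have hud : u * d = 1 := inv_mul_cancel₀ hd
  obtain ⟨α, hAeq⟩ := hAP
  rw [ha] at hAeq
  obtain ⟨y₀, hYeq⟩ := hYAP
  have hYcard : #(DU B C (univ.erase i)) = L := by rw [card_DU_BC hS hA, hL]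
  rw [hYcard] at hYeq
  -- the normalisation
  set t : Fin N → ZMod p := fun k => if k = i then -(u * α) else 0 with ht
  have hti : t i = -(u * α) := by simp [ht]
  set β : ZMod p := u * α - u * β₀ with hβ
  set γ : ZMod p := ((a - 1 : ℕ) : ZMod p) + β - u * y₀ with hγ
  have hS2 : IsSTPP (fun k => (A k).image (u * ·)) (fun k => (B k).image (u * ·)) (fun k => (C k).image (u * ·)) := isSTPP_dilate hS hu0
  have hS3 := IsSTPP.translate_shiftBC hS2 t β γ
  set A3 : Fin N → Finset (ZMod p) := fun k => ((A k).image (u * ·)).image (· + t k) with hA3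
  set B3 : Fin N → Finset (ZMod p) := fun k => (((B k).image (u * ·)).image (· + t k)).image (· + β) with hB3
  set C3 : Fin N → Finset (ZMod p) := fun k => (((C k).image (u * ·)).image (· + t k)).image (· + γ) with hC3
  have hS3' : IsSTPP A3 B3 C3 := hS3
  have hmemA3 : ∀ k x, x ∈ A3 k ↔ ∃ v ∈ A k, u * v + t k = x := by
    intro k x; simp only [hA3, mem_image, exists_exists_and_eq_and]
  have hmemB3 : ∀ k x, x ∈ B3 k ↔ ∃ v ∈ B k, u * v + (t k + β) = x := by
    intro k x; simp only [hB3, mem_image, exists_exists_and_eq_and, add_assoc]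
  have hmemC3 : ∀ k x, x ∈ C3 k ↔ ∃ v ∈ C k, u * v + (t k + γ) = x := by
    intro k x; simp only [hC3, mem_image, exists_exists_and_eq_and, add_assoc]
  have hinjA : ∀ k, Function.Injective fun v : ZMod p => u * v + t k := fun k v v' h => by
    have := mul_left_cancel₀ hu0 (add_right_cancel h); exact this
  have hinjB : ∀ k, Function.Injective fun v : ZMod p => u * v + (t k + β) := fun k v v' h => by
    have := mul_left_cancel₀ hu0 (add_right_cancel h); exact this
  have hinjC : ∀ k, Function.Injective fun v : ZMod p => u * v + (t k + γ) := fun k v v' h => by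
    have := mul_left_cancel₀ hu0 (add_right_cancel h); exact this
  have hA3eq : ∀ k, A3 k = (A k).image fun v => u * v + t k := fun k => by ext x; rw [hmemA3, mem_image]
  have hB3eq : ∀ k, B3 k = (B k).image fun v => u * v + (t k + β) := fun k => by ext x; rw [hmemB3, mem_image]
  have hC3eq : ∀ k, C3 k = (C k).image fun v => u * v + (t k + γ) := fun k => by ext x; rw [hmemC3, mem_image]
  have hA3ne : ∀ k, (A3 k).Nonempty := fun k => by rw [hA3eq]; exact (hA _).image _
  have hB3ne : ∀ k, (B3 k).Nonempty := fun k => by rw [hB3eq]; exact (hB _).image _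
  have hC3ne : ∀ k, (C3 k).Nonempty := fun k => by rw [hC3eq]; exact (hC _).image _
  have hcardA : ∀ k, #(A3 k) = #(A k) := fun k => by rw [hA3eq, card_image_of_injective _ (hinjA k)]
  have hcardB : ∀ k, #(B3 k) = #(B k) := fun k => by rw [hB3eq, card_image_of_injective _ (hinjB k)]
  have hcardC : ∀ k, #(C3 k) = #(C k) := fun k => by rw [hC3eq, card_image_of_injective _ (hinjC k)]
  have ha3 : #(A3 i) = a := by rw [hcardA, ha]
  have hc3 : #(C3 i) = c := by rw [hcardC, hc]
  have hz3 : ∑ k ∈ univ.erase i, #(A3 k) * #(C3 k) = z := by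
    rw [← hz]; exact Finset.sum_congr rfl fun k _ => by rw [hcardA, hcardC]
  have hL3 : ∑ k ∈ univ.erase i, #(B3 k) * #(C3 k) = L := by
    rw [← hL]; exact Finset.sum_congr rfl fun k _ => by rw [hcardB, hcardC]
  have hszs3 : ks.map (fun k => (#(A3 k), #(B3 k), #(C3 k))) = szs := by
    rw [← hszs]; exact List.map_congr_left fun k _ => by rw [hcardA, hcardB, hcardC]
  -- normal-form data
  have hA3i : A3 i = (Finset.range a).image fun k : ℕ => (k : ZMod p) := by
    ext x
    rw [hmemA3, hAeq, hti, mem_image]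
    constructor
    · rintro ⟨v, hv, rfl⟩
      obtain ⟨k, hk, rfl⟩ := mem_apFinset.1 hv
      refine ⟨k, mem_range.2 hk, ?_⟩
      rw [nsmul_eq_mul]; linear_combination (-(k : ZMod p)) * hud
    · rintro ⟨k, hk, rfl⟩
      refine ⟨α + k • d, mem_apFinset.2 ⟨k, mem_range.1 hk, rfl⟩, ?_⟩
      rw [nsmul_eq_mul]; linear_combination (k : ZMod p) * hud
  have hY3 : DU B3 C3 (univ.erase i) = (Finset.range L).image fun tt : ℕ => ((a - 1 : ℕ) : ZMod p) + (tt : ZMod p) := by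
    rw [DU_eq_image_affine u (γ - β) (fun k => t k + β) (fun k => t k + γ) (fun k => by ring) hmemB3 hmemC3, hYeq]
    ext x
    simp only [mem_image, mem_apFinset]
    constructor
    · rintro ⟨y, ⟨m, hm, rfl⟩, rfl⟩
      refine ⟨m, mem_range.2 hm, ?_⟩
      rw [nsmul_eq_mul, hγ]; linear_combination (-(m : ZMod p)) * hud
    · rintro ⟨m, hm, rfl⟩
      refine ⟨y₀ + m • d, ⟨m, mem_range.1 hm, rfl⟩, ?_⟩
      rw [nsmul_eq_mul, hγ]; linear_combination (m : ZMod p) * hud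
  have key := caseADeadT_false_of_normal_form hS3' hA3ne hB3ne hC3ne i hI ha3 hc3 hz3 hL3 hap hA3i hY3 ks hks hksi hszs3 hdead
  have hB3i : (B3 i).image ZMod.val = (B i).image fun x => (d⁻¹ * (x - β₀)).val := by
    rw [hB3eq, image_image]
    refine image_congr fun x _ => ?_
    show (u * x + (t i + β)).val = (d⁻¹ * (x - β₀)).val
    rw [hti, hβ, hu]; congr 1; ring
  rw [hB3i] at key
  exact key

/-! ## §3 The law: cases A and B′ by rows up to dihedral symmetry, leaving case C -/

/-- **Slack-2 law for several other blocks, cases A and B′ by rows.**  For an STPP family of `ℤ/p` with `N ≥ 2` non-empty blocks, block `i` read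
`(a, b, c)`, the other blocks `ks` with `z = Σ a_k c_k`, `L = Σ b_k c_k`, at slack 2 (`z + b + vol + a + L = p`, `a, b, z, L ≥ 2`): rows over the free
shapes up to dihedral symmetry — case A `dihedralSmaller p Q ∨ caseADeadT p a c L z Q tblA` for the `b`-shapes (table `tblA` dead for the sizes
`szsA = [(a_k, b_k, c_k)]`), case B′ `dihedralSmaller p Q ∨ caseADeadT p b c z L Q tblB` for the `a`-shapes (table `tblB` dead for `szsB = [(b_k, a_k, c_k)]`,
the role-swapped family) — leave only case (C): `#SY = a + L`, `#T = b + z`, `W ⊔ SY ⊔ T = ℤ/p`. [cite: CohnKleinbergSzegedyUmans2005, Def. 5.1]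
[cite: Vosper1956, main theorem; Nathanson1996, Thm 2.7] -/
theorem slack_two_caseC_of_rowsT {N : ℕ} {A B C : Fin N → Finset (ZMod p)} (hS : IsSTPP A B C)
    (hA : ∀ k, (A k).Nonempty) (hB : ∀ k, (B k).Nonempty) (hC : ∀ k, (C k).Nonempty) (i : Fin N)
    (hI : ((univ : Finset (Fin N)).erase i).Nonempty) {a b c L z vol : ℕ} (ha : #(A i) = a) (hb : #(B i) = b) (hc : #(C i) = c)
    (hz : ∑ k ∈ univ.erase i, #(A k) * #(C k) = z) (hL : ∑ k ∈ univ.erase i, #(B k) * #(C k) = L)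
    (hvol : a * b * c = vol) (hslack : z + b + vol + a + L = p) (h2a : 2 ≤ a) (h2b : 2 ≤ b) (h2z : 2 ≤ z) (h2L : 2 ≤ L)
    (ks : List (Fin N)) (hks : ks.Nodup) (hksi : ∀ k, k ∈ ks ↔ k ≠ i) {szsA szsB : List (ℕ × ℕ × ℕ)}
    (hszsA : ks.map (fun k => (#(A k), #(B k), #(C k))) = szsA) (hszsB : ks.map (fun k => (#(B k), #(A k), #(C k))) = szsB)
    {tblA tblB : List (List ℕ × List ℕ)} (deadA : ∀ e ∈ tblA, CoverDead p N i szsA e.1 e.2)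
    (deadB : ∀ e ∈ tblB, CoverDead p N i szsB e.1 e.2)
    (rowsA : ∀ Q ∈ qShapes p b 0 ((p - 1).choose (b - 1)), dihedralSmaller p Q = true ∨ caseADeadT p a c L z Q tblA = true)
    (rowsB : ∀ Q ∈ qShapes p a 0 ((p - 1).choose (a - 1)), dihedralSmaller p Q = true ∨ caseADeadT p b c z L Q tblB = true) :
    #((A i).image (fun x => (0 : ZMod p) - x) + DU B C (univ.erase i)) = a + L ∧
      #((B i).image (fun x => (0 : ZMod p) - x) + DU A C (univ.erase i)) = b + z ∧
      (((A i) ×ˢ ((B i) ×ˢ (C i))).image fun q : ZMod p × ZMod p × ZMod p => (0 : ZMod p) + q.2.2 - q.1 - q.2.1) ∪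
          ((A i).image (fun x => (0 : ZMod p) - x) + DU B C (univ.erase i)) ∪
          ((B i).image (fun x => (0 : ZMod p) - x) + DU A C (univ.erase i)) = univ := by
  have hvol' : #(A i) * #(B i) * #(C i) = vol := by rw [ha, hb, hc, hvol]
  rcases slack_two_shapes hS hA hB hC i hI ha hb hvol' hz hL hslack h2a h2b h2z h2L with
    ⟨d, hd, hAP, hYAP, -, -⟩ | ⟨e, he, hBP, hZAP, -, -⟩ | h3
  · exfalso
    obtain ⟨β₀, hβ₀, ε, hε, hmin⟩ := exists_dihedralSmaller_false (hB i) d⁻¹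
    have hεd : (ε * d) ≠ 0 := mul_ne_zero (by rcases hε with rfl | rfl <;> simp) hd
    have hAP' : IsAP (A i) (ε * d) := by
      rcases hε with rfl | rfl
      · rwa [one_mul]
      · rw [neg_one_mul]; exact IsAP.neg_diff hAP
    have hYAP' : IsAP (DU B C (univ.erase i)) (ε * d) := by
      rcases hε with rfl | rfl
      · rwa [one_mul]
      · rw [neg_one_mul]; exact IsAP.neg_diff hYAP
    have hinv : (ε * d)⁻¹ = ε * d⁻¹ := by
      rcases hε with rfl | rfl
      · rw [one_mul, one_mul]
      · rw [neg_one_mul, neg_one_mul, inv_neg]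
    have key := caseADeadT_false_of_isAP hS hA hB hC i hI ha hc hz hL (by omega) hεd hAP' hYAP' β₀ ks hks hksi hszsA deadA
    rw [hinv] at key
    have hu0 : ε * d⁻¹ ≠ 0 := by rw [← hinv]; exact inv_ne_zero hεd
    rcases rowsA _ (valShape_mem_qShapes hu0 hβ₀ hb) with h | h
    · rw [hmin] at h; exact Bool.noConfusion h
    · rw [key] at h; exact Bool.noConfusion h
  · exfalso
    have hS' : IsSTPP B A C := STPP222SqNeg.isSTPP_swapBC (stpp_rotate hS)
    obtain ⟨α₀, hα₀, ε, hε, hmin⟩ := exists_dihedralSmaller_false (hA i) e⁻¹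
    have hεe : (ε * e) ≠ 0 := mul_ne_zero (by rcases hε with rfl | rfl <;> simp) he
    have hBP' : IsAP (B i) (ε * e) := by
      rcases hε with rfl | rfl
      · rwa [one_mul]
      · rw [neg_one_mul]; exact IsAP.neg_diff hBP
    have hZAP' : IsAP (DU A C (univ.erase i)) (ε * e) := by
      rcases hε with rfl | rfl
      · rwa [one_mul]
      · rw [neg_one_mul]; exact IsAP.neg_diff hZAP
    have hinv : (ε * e)⁻¹ = ε * e⁻¹ := by
      rcases hε with rfl | rfl
      · rw [one_mul, one_mul]
      · rw [neg_one_mul, neg_one_mul, inv_neg]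
    have key := caseADeadT_false_of_isAP hS' hB hA hC i hI hb hc hL hz (by omega) hεe hBP' hZAP' α₀ ks hks hksi hszsB deadB
    rw [hinv] at key
    have hu0 : ε * e⁻¹ ≠ 0 := by rw [← hinv]; exact inv_ne_zero hεe
    rcases rowsB _ (valShape_mem_qShapes hu0 hα₀ ha) with h | h
    · rw [hmin] at h; exact Bool.noConfusion h
    · rw [key] at h; exact Bool.noConfusion h
  · exact h3

end Summit.MatrixMultiplication.OmegaCensus.CubeNB.S2
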